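import Summits.Ventures.GridStability.Lyapunov.WSCC9LossySlab7495
import Summits.Ventures.GridStability.Lyapunov.WSCC9LossySlabRoa
import Summits.Ventures.GridStability.Lyapunov.WSCC9LossySlabDual33
import HarnessLib

/-!
# Rider «#35‴ LANE-V-7.495°» — the sector hypothesis at `γ = 2·arctan(131/2000)` by exact rational tests,
# the rank-one level, THE SENTENCE, and THE BRACKET with «#74′» (file 3 of 3)

Same shape as lane V's `WSCC9LossySlabRoa.lean` (lyap-1) for the rider's certificate `WSCC9LossySlab7495.cert`
(file 2): `hsec` from file 1's decided `channel_tests` through lane V's `sector_of_tests` BY NAME; `hlev`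
from `level_test`/`gammaLo_test`; the region sentence `lossy_slab_roa` for every solution of the printed-lossy
WSCC9 classical model via model-1's bridge `WSCC9.hasDerivWithinAt_lurieState`; and the CLASS BRACKET: the
typed slab/Popov class on `M′` is NON-EMPTY at `2·arctan(131/2000)` (this rider) and EMPTY from
`2·arctan(33/500)` on («#74′», `WSCC9LossySlabDual33.slabClass_empty`) — «class optimum ∈
[2·arctan(131/2000), 2·arctan(33/500)] ≈ [7.495°, 7.552°]», closed at the left; the rider's window is
STRICTLY above ★ #35 lane V's `2·arctan(13/200)`.

THREE COLUMNS. CERTIFIED (kernel): for the MODEL M′ = WSCC9-postB-SPdamp-h12 in Pai's DIRECTED Lur'e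
presentation `WSCC9.lurieSystem` (Kron reduction WITH transfer conductances, printed damping
`D/M = 1/10, 1/5, 3/10`), CLASS = the slab + Popov certificate of file 2 on the window
`|σ_k − δ*_k| < 2·arctan(131/2000)` (≈ 7.495°) of all nine directed channels with the rank-one level
`c = 716699207315223/6578897890000000000`: every solution whose Lur'e state starts in that well keeps it for
all `t ≥ 0` and has Lur'e state `→ 0`. VALIDATED: sos-2's float solves (level-optimised programme does not
round at this window; the ε-objective does); the inner-ball reading of `c` — `|x|² ≤ c/t_W ⇒ V ≤ c` with
sos-2's `t_W = 939581/2²⁰` s.t. `t_W·1 − (P + Cᵀ·diag(λ_k b_k)·C) ⪰ 0`, radius `√(c/t_W) ≈ 0.63°` — is a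
VALIDATED reading (ref-2 LEDGER-2 row 276 (a)); the rider's level `c ≈ 1.09·10⁻⁴` is 7.3× SMALLER than ★ #35's
(wells not nested): the token is about the bracket's left end `7.438° → 7.495°`, never «a larger region».
MODELLED: as ★ #35 (MV-2 + MV-P + MV-SPD + MV-h12). No sentence of this file says a grid is stable.
[cite: Pai1981, §2.16 Theorem [18] eqs. (2.63)–(2.64) and §4.7.3 eqs. (4.115)–(4.117); VuTuritsyn2017, §4.3 Theorem 1 with eq. (V_min); BoydVandenberghe2004, §5.9.4 (5.97)–(5.98)]
-/

noncomputable section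

open Real Set Filter Matrix
open scoped Topology
open Literature.MathematicalPhysics.PowerSystems
open Literature.MathematicalPhysics.PowerSystems.LyapunovFunctionFamily
open Literature.Computation.Certificates
open Summit.Ventures.GridStability.Models
open Summit.Ventures.GridStability.Lyapunov.WSCC9LossySlab (e1 eκ e2 sector_of_tests)

namespace Summit.Ventures.GridStability.Lyapunov.WSCC9LossySlab7495

/-! ### The slab half-width `γ = 2·arctan(131/2000)` -/

/-- The slab half-width `γ = 2·arctan u`, `u = 131/2000` (≈ 7.495°). -/
def γ : ℝ := 2 * Real.arctan ((uQ : ℚ) : ℝ)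

/-- `γ` is the literal window `2·arctan(131/2000)` of the rider's name. -/
theorem γ_eq : γ = 2 * Real.arctan (131 / 2000) := by
  unfold γ; norm_num [uQ]

/-- `cos γ = c_γ` (rational; cast form feeding `hsec`). -/
private theorem cos_γ_cast : Real.cos γ = ((cgQ : ℚ) : ℝ) := by
  unfold γ cgQ
  rw [Lyapunov.StructurePreserving.cos_two_mul_arctan]
  push_cast
  ring

/-- `sin γ = s_γ` (rational; cast form feeding `hsec`). -/
private theorem sin_γ_cast : Real.sin γ = ((sgQ : ℚ) : ℝ) := by
  unfold γ sgQ
  rw [Lyapunov.StructurePreserving.sin_two_mul_arctan]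
  push_cast
  ring

/-- `0 ≤ γ ≤ π/2`. -/
theorem γ_range : 0 ≤ γ ∧ γ ≤ π / 2 := by
  have hu : (0 : ℝ) ≤ ((uQ : ℚ) : ℝ) := by exact_mod_cast uQ_pos_lt.1.le
  have hu1 : ((uQ : ℚ) : ℝ) < 1 := by exact_mod_cast uQ_pos_lt.2
  exact ⟨Lyapunov.StructurePreserving.two_mul_arctan_nonneg hu,
    (Lyapunov.StructurePreserving.two_mul_arctan_lt_pi_div_two hu1).le⟩

/-- `γ_lo < γ` (the rational `γ_lo = 130719/10⁶` passes `γ_lo²(1 + u²) ≤ 4u²`; feeds `hlev`). -/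
private theorem gammaLo_lt_γ_cast : ((gammaLoQ : ℚ) : ℝ) < γ := by
  have h := gammaLo_test
  have h0 : (0 : ℝ) ≤ ((gammaLoQ : ℚ) : ℝ) := by exact_mod_cast h.1
  have hu : (0 : ℝ) < ((uQ : ℚ) : ℝ) := by exact_mod_cast uQ_pos_lt.1
  have h2 : ((gammaLoQ : ℚ) : ℝ) ^ 2 * (1 + ((uQ : ℚ) : ℝ) ^ 2) ≤ 4 * ((uQ : ℚ) : ℝ) ^ 2 := by
    exact_mod_cast h.2
  exact StructurePreserving.lt_two_arctan_of_sq_le hu h0 h2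

/-- **The rider's window is strictly ABOVE ★ #35 lane V's**: `2·arctan(13/200) < 2·arctan(131/2000)`. -/
theorem γV_lt_γ : WSCC9LossySlab.γ < γ := by
  unfold WSCC9LossySlab.γ γ
  have h : ((WSCC9LossySlab.uQ : ℚ) : ℝ) < ((uQ : ℚ) : ℝ) := by norm_num [WSCC9LossySlab.uQ, uQ]
  have := Real.arctan_strictMono h
  linarith

/-- **… and strictly BELOW «#74′»'s emptiness threshold**: `2·arctan(131/2000) < 2·arctan(33/500)`. -/
theorem γ_lt_γ33 : γ < 2 * Real.arctan (33 / 500) := by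
  rw [γ_eq]
  have := Real.arctan_strictMono (show (131 / 2000 : ℝ) < 33 / 500 by norm_num)
  linarith

/-! ### The sector hypothesis `hsec` at the new window -/

/-- **`hsec`** — the per-channel sector hypothesis of lit-6's slab theorem on the window
`2·arctan(131/2000)`: active channels by lane V's `sector_of_tests` + file 1's `channel_tests`; the three
weightless diagonal channels carry the trivial sector `[−1, 1]`. -/
theorem hsec : ∀ k ξ, |ξ - WSCC9.lurieSystem.δs k| ≤ 2 * Real.arctan (131 / 2000) →
    cert.a k ≤ Real.cos ξ ∧ Real.cos ξ ≤ cert.b k := by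
  intro k ξ hξ
  rw [← γ_eq] at hξ
  rw [cert_a, cert_b]
  by_cases hk : k.1 = k.2
  · have hab := diag_data k.1
    have hk' : k = (k.1, k.1) := by ext <;> simp [hk]
    have ha : a k = -1 := by
      unfold a aK eκ; rw [hk']; exact_mod_cast hab.1
    have hb : b k = 1 := by
      unfold b bK eκ; rw [hk']; exact_mod_cast hab.2.1
    rw [ha, hb]
    exact ⟨Real.neg_one_le_cos ξ, Real.cos_le_one ξ⟩
  · obtain ⟨ha0, hlo0, hlo, hup⟩ := channel_tests k hk
    have hE := WSCC9.postB_SPdamp_eqData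
    have hB : 0 < WSCC9.postB_SPdamp.toModel.B k.1 k.2 :=
      WSCC9.postB_SPdamp.toModel_B_pos WSCC9.postB_SPdamp_B_pos k.1 k.2 hk
    have hY : 0 < WSCC9.postB_SPdamp.toModel.Ypol k.1 k.2 := WSCC9.postB_SPdamp.toModel.Ypol_pos hB
    have hm : WSCC9.postB_SPdamp.toModel.Ypol k.1 k.2 *
        Real.cos (WSCC9.postB_SPdamp.angleOf k.1 - WSCC9.postB_SPdamp.angleOf k.2
          + WSCC9.postB_SPdamp.toModel.θpol k.1 k.2)
          = ((WSCC9.postB_SPdamp.dirMarginB k.1 k.2 : ℚ) : ℝ) := by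
      rw [WSCC9.postB_SPdamp.toModel.Ypol_mul_cos_add hB, WSCC9.postB_SPdamp.dirMarginB_cast hE]
    have hn : WSCC9.postB_SPdamp.toModel.Ypol k.1 k.2 *
        Real.sin (WSCC9.postB_SPdamp.angleOf k.1 - WSCC9.postB_SPdamp.angleOf k.2
          + WSCC9.postB_SPdamp.toModel.θpol k.1 k.2)
          = ((WSCC9.postB_SPdamp.dirSinB k.1 k.2 : ℚ) : ℝ) := by
      rw [WSCC9.postB_SPdamp.toModel.Ypol_mul_sin_add hB, WSCC9.postB_SPdamp.dirSinB_cast hE]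
    have hδ := WSCC9.postB_SPdamp_channelShift_abs_lt k
    have hY2 : WSCC9.postB_SPdamp.toModel.Ypol k.1 k.2 ^ 2 = ((WSCC9.postB_SPdamp.Ysq k.1 k.2 : ℚ) : ℝ) :=
      WSCC9.postB_SPdamp.Ypol_sq_cast k.1 k.2
    have hδs : WSCC9.lurieSystem.δs k
        = WSCC9.postB_SPdamp.angleOf k.1 - WSCC9.postB_SPdamp.angleOf k.2
          + WSCC9.postB_SPdamp.toModel.θpol k.1 k.2 := rfl
    rw [hδs] at hξ
    refine sector_of_tests (a := a k) (b := b k) hY hm hn hδ γ_range.1 γ_range.2 cos_γ_cast sin_γ_cast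
      ?_ ?_ ?_ ?_ ξ hξ
    · unfold a aK eκ; exact_mod_cast ha0
    · exact_mod_cast hlo0
    · unfold a aK eκ; rw [mul_comm, ← mul_comm (((aQ _ : ℚ) : ℝ) ^ 2), hY2]; exact_mod_cast hlo
    · rcases hup with h1 | ⟨h2, h3, h4, h5⟩
      · left; unfold b bK eκ; exact_mod_cast h1
      · right
        refine ⟨by exact_mod_cast h2, by unfold b bK eκ; exact_mod_cast h3, ?_, ?_⟩
        · rw [hY2]; exact_mod_cast h4
        · unfold b bK eκ; rw [hY2]; exact_mod_cast h5

/-! ### The rank-one level -/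

/-- **`hlev`**: `c < γ²/s_k` on every channel (decided `c·s_k < γ_lo²` and `γ_lo < γ`). -/
theorem hlev : ∀ k, ((cQ : ℚ) : ℝ) < (2 * Real.arctan (131 / 2000)) ^ 2 / s k := by
  intro k
  rw [← γ_eq, lt_div_iff₀ (s_pos k)]
  have h1 : ((cQ : ℚ) : ℝ) * s k < ((gammaLoQ : ℚ) : ℝ) ^ 2 := by
    unfold s; exact_mod_cast level_test (eκ k)
  have h0 : (0 : ℝ) ≤ ((gammaLoQ : ℚ) : ℝ) := by exact_mod_cast gammaLo_test.1
  have h2 : ((gammaLoQ : ℚ) : ℝ) ^ 2 < γ ^ 2 := pow_lt_pow_left₀ gammaLo_lt_γ_cast h0 two_ne_zero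
  exact h1.trans h2

/-! ### THE SENTENCE -/

/-- **Rider «#35‴ LANE-V-7.495°» — THE CERTIFIED REGION OF THE PRINTED-LOSSY WSCC9 CLASSICAL MODEL AT THE
WINDOW `2·arctan(131/2000)`.** MODEL M′ = `WSCC9.postB_SPdamp.toModel` (WSCC9 post-fault-B classical model,
Kron reduction WITH transfer conductances as printed h12, printed damping `D/M = 1/10, 1/5, 3/10`), read in
Pai's directed Lur'e presentation `WSCC9.lurieSystem`; CLASS = the slab + Popov certificate
`WSCC9LossySlab7495.cert` (sos-2 Λ `44a199a298d0bbbd`, centre route). STATEMENT: for every solution `c` of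
M′ on `univ` whose Lur'e state `x = (ω | σ − σ*)` starts in the slab `|σ_k − δ*_k| < 2·arctan(131/2000)`
(all nine directed channels) with `V(x(0)) ≤ c = 716699207315223/6578897890000000000`: the slab and the
level are kept for all `t ≥ 0` and `x(t) → 0`. Inner estimate; a priori over all solutions. No sentence
here says a grid is stable.
[cite: Pai1981, §2.16 Theorem [18] eqs. (2.63)–(2.64) and §4.7.3 eqs. (4.115)–(4.117); VuTuritsyn2017, §4.3 Theorem 1 with eq. (V_min)] -/
theorem lossy_slab_roa {c : ℝ → ClassicalSwing.State 3}
    (hc : WSCC9.postB_SPdamp.toModel.IsSolutionOn c univ)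
    (h0 : WSCC9.postB_SPdamp.lurieState WSCC9.postB_SPdamp.angleOf (c 0)
      ∈ WSCC9.lurieSystem.slab (fun _ => 2 * Real.arctan (131 / 2000)))
    (h0c : cert.V (WSCC9.postB_SPdamp.lurieState WSCC9.postB_SPdamp.angleOf (c 0)) ≤ ((cQ : ℚ) : ℝ)) :
    (∀ t, 0 ≤ t →
        WSCC9.postB_SPdamp.lurieState WSCC9.postB_SPdamp.angleOf (c t)
            ∈ WSCC9.lurieSystem.slab (fun _ => 2 * Real.arctan (131 / 2000)) ∧
          cert.V (WSCC9.postB_SPdamp.lurieState WSCC9.postB_SPdamp.angleOf (c t)) ≤ ((cQ : ℚ) : ℝ)) ∧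
      Tendsto (fun t => WSCC9.postB_SPdamp.lurieState WSCC9.postB_SPdamp.angleOf (c t)) atTop (𝓝 0) := by
  have key := cert.well_subset_regionOfAttraction_of_rankOne (γ := fun _ => 2 * Real.arctan (131 / 2000))
    hsec s_pos rankOne hlev h0 h0c
  exact key.2 (fun t => WSCC9.postB_SPdamp.lurieState WSCC9.postB_SPdamp.angleOf (c t)) rfl
    fun T t ht => WSCC9.hasDerivWithinAt_lurieState hc t

/-! ### THE BRACKET with «#74′» -/

/-- **THE CLASS BRACKET, closed at the left** (one kernel object): the typed slab/Popov certificate class on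
`M′ = WSCC9.lurieSystem` is NON-EMPTY with `hsec` at the window `2·arctan(131/2000)` (this rider's `cert`)
and EMPTY at every window `≥ 2·arctan(33/500)` («#74′», `WSCC9LossySlabDual33.slabClass_empty`): the class
optimum lies in `[2·arctan(131/2000), 2·arctan(33/500)]` ≈ `[7.495°, 7.552°]`. A statement about the
CERTIFICATE CLASS, not about the region of attraction of `M′`.
[cite: BoydVandenberghe2004, §5.9.4 (5.97)–(5.98); Pai1981, §2.16 Theorem [18]] -/
theorem classOptimum_bracket :
    (∃ Λ : SlabCertificate WSCC9.lurieSystem,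
      ∀ k ξ, |ξ - WSCC9.lurieSystem.δs k| ≤ 2 * Real.arctan (131 / 2000) →
        Λ.a k ≤ Real.cos ξ ∧ Real.cos ξ ≤ Λ.b k) ∧
    ∀ γ' : ℝ, 2 * Real.arctan (33 / 500) ≤ γ' → ¬ ∃ Λ : SlabCertificate WSCC9.lurieSystem,
      ∀ k ξ, |ξ - WSCC9.lurieSystem.δs k| ≤ γ' → Λ.a k ≤ Real.cos ξ ∧ Real.cos ξ ≤ Λ.b k :=
  ⟨⟨cert, hsec⟩, WSCC9LossySlabDual33.slabClass_empty⟩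

/-- The bracket's width in closed form: both ends are strictly ordered and the left end improves ★ #35's
`2·arctan(13/200)`: `2·arctan(13/200) < 2·arctan(131/2000) < 2·arctan(33/500)`. -/
theorem bracket_ends_ordered :
    WSCC9LossySlab.γ < 2 * Real.arctan (131 / 2000) ∧
      2 * Real.arctan (131 / 2000) < 2 * Real.arctan (33 / 500) := by
  refine ⟨?_, ?_⟩
  · have h := γV_lt_γ; rwa [γ_eq] at h
  · have h := γ_lt_γ33; rwa [γ_eq] at h

end Summit.Ventures.GridStability.Lyapunov.WSCC9LossySlab7495

end
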